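import Mathlib
import HarnessLib
import Summits.NavierStokesRegularity.NavierStokesRegularity.Theorems.UnthreadedDoorAntidynamoWallBeltramiModConst

/-!
# Route `UnthreadedDoor` / `ThreadingFlux`, crux `PoloidalLiouville` (stmt-NavierStokesRegularity-1222), antidynamo v2 skeleton (sha16 `4ebf5683127b`),
# WALL `stub_scalarLiouville`: CORE v7 — the two generalized-Beltrami hypotheses (C5), (C9) merged into the frame-free (C5'')

Support file (seat leafhand-ns-unthreadeddoor-2 g4, cell decomp-ns), `--supports stmt-NavierStokesRegularity-1222 --as helper`; theorems only.

By `ModConst.curl_eq_zero_of_lamb_curlFree_modConst_frequently` (p822418) a flow of the wall's class that is generalized Beltrami MODULO SOME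
CONSTANT DRIFT at a set of times accumulating inside `(−∞,0)` is irrotational.  Hence the core of the wall needs only the one free hypothesis

  (C5'') `∀ t₀ < 0, ¬ ∃ᶠ t → t₀, ∃ b ∈ ℝ³, curl ((v(t) − b) × curl v(t)) ≡ 0`

in place of (C5) (smooth frames on a far past; `farPast_frame_frequently` records (C5'') ⟹ (C5)) and (C9) (constant / real-analytic frames at
accumulating times):

* ★ `stubScalarLiouville_of_core_v7` — WALL ⟸ core v7 = (C1) analytic frame, (C2) dense vorticity support, (C3') no local flat direction at any
  instant, (C6) no local axisymmetry at any instant, (C7) local rigid symmetries only with exact equivariance, (C4') no rigid anti-symmetry at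
  accumulating times, (C5''), (C8) not `L³`-close to constants along any backward sequence;
* ★ `poloidalLiouville_of_core_v7` — … and the CRUX (route `UnthreadedDoor` decl) from core v7, by name.

HONEST LABEL: a by-name reduction certificate; the generic core (= (ML-a) of `…WallCentrePathAnalytic`) is OPEN; nothing here proves
`stub_scalarLiouville`, `PoloidalLiouville` (1222), or bears on Navier–Stokes regularity; no summit statement is proved.
[cite: KochNadirashviliSereginSverak2009, Thm 5.2 (arXiv:0709.3599 pp. 9–10)]
-/

noncomputable section

-- the summit and its single sub-problem share the name (CONVENTIONS §1)
set_option linter.dupNamespace false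

open scoped Topology InnerProductSpace RealInnerProductSpace ENNReal NNReal
open Filter Set Function MeasureTheory
open Literature.Analysis Literature.Analysis.FluidPDE

namespace Summit.NavierStokesRegularity.NavierStokesRegularity.Theorems.PoloidalLiouville.Antidynamo

open Summit.NavierStokesRegularity.NavierStokesRegularity.Theorems.PoloidalLiouville.CellFlux (conjAxis)

/-! ### ★ §5 Core v7: (C5) and (C9) merged into the frame-free (C5'') -/

/-- ★ **THE CORE OF THE WALL, v7**: core v6 (`stubScalarLiouville_of_core_v6`, p821303) with its two generalized-Beltrami hypotheses — (C5) «not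
generalized-Beltrami in any SMOOTH Galilean frame on a far past» and (C9) «not generalized-Beltrami in any CONSTANT frame at accumulating times» —
REPLACED by the single frame-free hypothesis (C5'') **at no set of times accumulating inside `(−∞,0)` is the slice generalized Beltrami modulo a
constant drift** (`∀ t₀ < 0, ¬ ∃ᶠ t → t₀, ∃ b, curl ((v(t) − b) × curl v(t)) ≡ 0`), which implies both ((C5): a smooth frame on a far past makes every
time of that far past admissible).  Remaining free hypotheses: (C1) analytic frame, (C2) dense vorticity support, (C3') no local flat direction at any
instant, (C6) no local axisymmetry at any instant, (C7) local rigid symmetries only with exact equivariance, (C4') no rigid anti-symmetry at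
accumulating times, (C5''), (C8) not `L³`-close to constants along any backward sequence.
[cite: KochNadirashviliSereginSverak2009, Thm 5.2 (arXiv:0709.3599 pp. 9–10)] -/
theorem stubScalarLiouville_of_core_v7
    (hcore : ∀ (v : ℝ → EuclideanSpace ℝ (Fin 3) → EuclideanSpace ℝ (Fin 3)) (x₀ : EuclideanSpace ℝ (Fin 3))
      (T : ℝ → EuclideanSpace ℝ (Fin 3) → ℝ),
      Literature.Analysis.FluidPDE.IsBoundedAncientMildSolution 1 v →
      (∀ t < 0, AEStronglyMeasurable (v t) volume) →
      ContDiffOn ℝ (⊤ : ℕ∞) (Function.uncurry v) (Set.Iio 0 ×ˢ Set.univ) →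
      ContDiffOn ℝ (⊤ : ℕ∞) (Function.uncurry T) (Set.Iio 0 ×ˢ ({x₀}ᶜ : Set (EuclideanSpace ℝ (Fin 3)))) →
      (∃ C : ℝ, ∀ t < 0, ∀ x, |T t x| ≤ C) →
      (∀ t < 0, ∀ x, Literature.Analysis.FluidPDE.curl (v t) x =
        Literature.Analysis.FluidPDE.cross (gradient (T t) x) (x - x₀)) →
      (∀ t < 0, ∀ x, x ≠ x₀ →
        Literature.Analysis.FluidPDE.cross
            (gradient (fun z => deriv (fun s => T s z) t + inner ℝ (v t z) (gradient (T t) z)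
              - Laplacian.laplacian (T t) z) x) (x - x₀) =
          Literature.Analysis.FluidPDE.cross (gradient (fun z => inner ℝ (v t z) (z - x₀)) x) (gradient (T t) x)) →
      -- (C1) analytic in the given frame
      AnalyticOnNhd ℝ (Function.uncurry v) (Iio (0 : ℝ) ×ˢ (univ : Set (EuclideanSpace ℝ (Fin 3)))) →
      -- (C2) dense non-vanishing of the vorticity at every time
      (∀ t < 0, Dense {x : EuclideanSpace ℝ (Fin 3) | curl (v t) x ≠ 0}) →
      -- (C3') no local flat direction at any instant
      (∀ t < 0, ¬ ∃ e : EuclideanSpace ℝ (Fin 3), e ≠ 0 ∧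
        ∃ U : Set (EuclideanSpace ℝ (Fin 3)), IsOpen U ∧ U.Nonempty ∧ ∀ x ∈ U, ⟪e, curl (v t) x⟫ = 0) →
      -- (C6) no local axisymmetry of the straightened vorticity at any instant, about any axis
      (∀ t < 0, ∀ (R : EuclideanSpace ℝ (Fin 3) ≃ₗᵢ[ℝ] EuclideanSpace ℝ (Fin 3)) (x₁ : EuclideanSpace ℝ (Fin 3))
        (U : Set (EuclideanSpace ℝ (Fin 3))), IsOpen U → U.Nonempty →
        ¬ ∀ θ : ℝ, ∀ y ∈ U, curl (conjAxis R x₁ (v t)) (rotZ θ y) = rotZ θ (curl (conjAxis R x₁ (v t)) y)) →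
      -- (C7) every local rigid symmetry of the vorticity at any instant is an exact equivariance of the velocity about `x₀` at all times
      (∀ t < 0, ∀ (R : EuclideanSpace ℝ (Fin 3) ≃ₗᵢ[ℝ] EuclideanSpace ℝ (Fin 3)) (x₁ : EuclideanSpace ℝ (Fin 3))
        (U : Set (EuclideanSpace ℝ (Fin 3))), IsOpen U → U.Nonempty →
        (∀ y ∈ U, curl (v t) (x₁ + R y) =
          (R : EuclideanSpace ℝ (Fin 3) →L[ℝ] EuclideanSpace ℝ (Fin 3)).det • R (curl (v t) (x₁ + y))) →
        ∀ s < 0, ∀ y, v s (x₀ + R y) = R (v s (x₀ + y))) →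
      -- (C4') not anti-symmetric under any rigid motion at any set of times accumulating inside `(−∞,0)`
      (∀ (R : EuclideanSpace ℝ (Fin 3) ≃ₗᵢ[ℝ] EuclideanSpace ℝ (Fin 3)) (b : EuclideanSpace ℝ (Fin 3)) (t₀ : ℝ), t₀ < 0 →
        ¬ ∃ᶠ t in 𝓝[≠] t₀, ∀ y, curl (v t) (R y + b) =
          -((R : EuclideanSpace ℝ (Fin 3) →L[ℝ] EuclideanSpace ℝ (Fin 3)).det • R (curl (v t) y))) →
      -- (C5'') NEW, replaces (C5) and (C9): never generalized-Beltrami modulo a constant drift at times accumulating inside `(−∞,0)`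
      (∀ t₀ < 0, ¬ ∃ᶠ t in 𝓝[≠] t₀, ∃ b : EuclideanSpace ℝ (Fin 3),
        ∀ x, curl (fun y => cross (v t y - b) (curl (v t) y)) x = 0) →
      -- (C8) not `L³`-close to constants along any sequence of times `τ_k → −∞`
      (¬ ∃ (b : ℕ → EuclideanSpace ℝ (Fin 3)) (τ : ℕ → ℝ) (M : ℝ≥0),
        (∀ k, τ k < 0) ∧ Tendsto τ atTop atBot ∧
        ∀ k, eLpNorm (fun x => v (τ k) x - b k) 3 (volume : Measure (EuclideanSpace ℝ (Fin 3))) ≤ (M : ℝ≥0∞)) →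
      ∀ t < 0, ∀ x, Literature.Analysis.FluidPDE.cross (gradient (T t) x) (x - x₀) = 0) :
    StubScalarLiouville := by
  refine stubScalarLiouville_of_core_v6 fun v x₀ T hB hm hsm hT hTb hrep hE hC1 hC2 hC3 hC6 hC7 hC4 _hC5 hC8 _hC9 => ?_
  -- a toroidal field is tangent to the spheres about its centre
  have hun : ∀ t < 0, ∀ x, ⟪x - x₀, curl (v t) x⟫ = 0 := fun t ht x => by
    rw [hrep t ht x]
    simp [cross, crossProduct, PiLp.inner_apply, Fin.sum_univ_three]
    ring
  by_cases h0 : ∀ t < 0, ∀ x, curl (v t) x = 0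
  · intro t ht x
    rw [← hrep t ht x]
    exact h0 t ht x
  -- otherwise (C5'') holds by the frame-free accumulating-times closer
  have hC5'' : ∀ t₀ < 0, ¬ ∃ᶠ t in 𝓝[≠] t₀, ∃ b : EuclideanSpace ℝ (Fin 3),
      ∀ x, curl (fun y => cross (v t y - b) (curl (v t) y)) x = 0 :=
    fun t₀ ht₀ hfr => h0 (ModConst.curl_eq_zero_of_lamb_curlFree_modConst_frequently v x₀ hB hm hsm hun ⟨t₀, ht₀, hfr⟩)
  exact hcore v x₀ T hB hm hsm hT hTb hrep hE hC1 hC2 hC3 hC6 hC7 hC4 hC5'' hC8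

/-- ★ **… AND THE CRUX from core v7** (route `UnthreadedDoor` decl; composition p793469 by name). -/
theorem poloidalLiouville_of_core_v7
    (hcore : ∀ (v : ℝ → EuclideanSpace ℝ (Fin 3) → EuclideanSpace ℝ (Fin 3)) (x₀ : EuclideanSpace ℝ (Fin 3))
      (T : ℝ → EuclideanSpace ℝ (Fin 3) → ℝ),
      Literature.Analysis.FluidPDE.IsBoundedAncientMildSolution 1 v →
      (∀ t < 0, AEStronglyMeasurable (v t) volume) →
      ContDiffOn ℝ (⊤ : ℕ∞) (Function.uncurry v) (Set.Iio 0 ×ˢ Set.univ) →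
      ContDiffOn ℝ (⊤ : ℕ∞) (Function.uncurry T) (Set.Iio 0 ×ˢ ({x₀}ᶜ : Set (EuclideanSpace ℝ (Fin 3)))) →
      (∃ C : ℝ, ∀ t < 0, ∀ x, |T t x| ≤ C) →
      (∀ t < 0, ∀ x, Literature.Analysis.FluidPDE.curl (v t) x =
        Literature.Analysis.FluidPDE.cross (gradient (T t) x) (x - x₀)) →
      (∀ t < 0, ∀ x, x ≠ x₀ →
        Literature.Analysis.FluidPDE.cross
            (gradient (fun z => deriv (fun s => T s z) t + inner ℝ (v t z) (gradient (T t) z)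
              - Laplacian.laplacian (T t) z) x) (x - x₀) =
          Literature.Analysis.FluidPDE.cross (gradient (fun z => inner ℝ (v t z) (z - x₀)) x) (gradient (T t) x)) →
      AnalyticOnNhd ℝ (Function.uncurry v) (Iio (0 : ℝ) ×ˢ (univ : Set (EuclideanSpace ℝ (Fin 3)))) →
      (∀ t < 0, Dense {x : EuclideanSpace ℝ (Fin 3) | curl (v t) x ≠ 0}) →
      (∀ t < 0, ¬ ∃ e : EuclideanSpace ℝ (Fin 3), e ≠ 0 ∧
        ∃ U : Set (EuclideanSpace ℝ (Fin 3)), IsOpen U ∧ U.Nonempty ∧ ∀ x ∈ U, ⟪e, curl (v t) x⟫ = 0) →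
      (∀ t < 0, ∀ (R : EuclideanSpace ℝ (Fin 3) ≃ₗᵢ[ℝ] EuclideanSpace ℝ (Fin 3)) (x₁ : EuclideanSpace ℝ (Fin 3))
        (U : Set (EuclideanSpace ℝ (Fin 3))), IsOpen U → U.Nonempty →
        ¬ ∀ θ : ℝ, ∀ y ∈ U, curl (conjAxis R x₁ (v t)) (rotZ θ y) = rotZ θ (curl (conjAxis R x₁ (v t)) y)) →
      (∀ t < 0, ∀ (R : EuclideanSpace ℝ (Fin 3) ≃ₗᵢ[ℝ] EuclideanSpace ℝ (Fin 3)) (x₁ : EuclideanSpace ℝ (Fin 3))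
        (U : Set (EuclideanSpace ℝ (Fin 3))), IsOpen U → U.Nonempty →
        (∀ y ∈ U, curl (v t) (x₁ + R y) =
          (R : EuclideanSpace ℝ (Fin 3) →L[ℝ] EuclideanSpace ℝ (Fin 3)).det • R (curl (v t) (x₁ + y))) →
        ∀ s < 0, ∀ y, v s (x₀ + R y) = R (v s (x₀ + y))) →
      (∀ (R : EuclideanSpace ℝ (Fin 3) ≃ₗᵢ[ℝ] EuclideanSpace ℝ (Fin 3)) (b : EuclideanSpace ℝ (Fin 3)) (t₀ : ℝ), t₀ < 0 →
        ¬ ∃ᶠ t in 𝓝[≠] t₀, ∀ y, curl (v t) (R y + b) =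
          -((R : EuclideanSpace ℝ (Fin 3) →L[ℝ] EuclideanSpace ℝ (Fin 3)).det • R (curl (v t) y))) →
      (∀ t₀ < 0, ¬ ∃ᶠ t in 𝓝[≠] t₀, ∃ b : EuclideanSpace ℝ (Fin 3),
        ∀ x, curl (fun y => cross (v t y - b) (curl (v t) y)) x = 0) →
      (¬ ∃ (b : ℕ → EuclideanSpace ℝ (Fin 3)) (τ : ℕ → ℝ) (M : ℝ≥0),
        (∀ k, τ k < 0) ∧ Tendsto τ atTop atBot ∧
        ∀ k, eLpNorm (fun x => v (τ k) x - b k) 3 (volume : Measure (EuclideanSpace ℝ (Fin 3))) ≤ (M : ℝ≥0∞)) →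
      ∀ t < 0, ∀ x, Literature.Analysis.FluidPDE.cross (gradient (T t) x) (x - x₀) = 0) :
    Summit.NavierStokesRegularity.NavierStokesRegularity.Theses.UnthreadedDoor.PoloidalLiouville :=
  poloidalLiouville_of_stubScalarLiouville' (stubScalarLiouville_of_core_v7 hcore)

/-- For the record, (C5'') ⟹ (C5): a smooth (indeed any) Galilean frame `b` in which the Lamb vector is curl-free on a whole far past `(−∞, t₁)` makes
every time of that far past admissible, so the admissible times accumulate at `t₁ − 1 < 0`. [folklore] -/
theorem farPast_frame_frequently {v : ℝ → EuclideanSpace ℝ (Fin 3) → EuclideanSpace ℝ (Fin 3)} {t₁ : ℝ} (ht₁ : t₁ ≤ 0)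
    {b : ℝ → EuclideanSpace ℝ (Fin 3)} (hlamb : ∀ t < t₁, ∀ x, curl (fun y => cross (v t y - b t) (curl (v t) y)) x = 0) :
    ∃ t₀ < 0, ∃ᶠ t in 𝓝[≠] t₀, ∃ c : EuclideanSpace ℝ (Fin 3), ∀ x, curl (fun y => cross (v t y - c) (curl (v t) y)) x = 0 := by
  refine ⟨t₁ - 1, by linarith, ?_⟩
  have hev0 : ∀ᶠ t in 𝓝 (t₁ - 1), t < t₁ := Iio_mem_nhds (by linarith)
  have hev : ∀ᶠ t in 𝓝[≠] (t₁ - 1), t < t₁ := hev0.filter_mono nhdsWithin_le_nhds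
  exact (hev.mono fun t ht => ⟨b t, hlamb t ht⟩).frequently

end Summit.NavierStokesRegularity.NavierStokesRegularity.Theorems.PoloidalLiouville.Antidynamo

end
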